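import Summits.QuantumFields.YangMills.Theorems.BalabanUVNodesN08AlphaLoop28Threshold

/-!
# Route «BalabanUVNodes», Track-A DAG node N08 = [Balaban1985UV3] Thm 1 p. 257 ∕ Thm 2 p. 272 — THE (α) CLAUSE FROM «DATA ∧ THREE IN-EDGE
# FACES» ALONE: the coupling window `g_k ≤ γ_loop` FOLDED into the family threshold («ε₀ depending on g only», p. 256 L15–18) and the
# constants condition `C68 ≤ 2L²B₃` FOLDED into [7]'s single regularity constant

Cell `pub-ymgap`, seat `pub-ymgap-dag-n08-d` gen 3 (director-ym R134 row «CLASS-I in-edge conclusions at the (α) granularity of `RunAlpha`»; census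
`HOME/pub-ymgap-dag-n08-b/N08-ALPHA-ROWS.md` 6a78a4e68c218d11 §2; HUMAN RULING D-0062; chair R424 venue).  `bears_on: R4∕N08`; filed `--supports
stmt-QuantumFields-19903 --as helper` (K1′ `StabilityBAtRecordR12e`, rev 15).  Sorry-free, standard axioms; two closed-form definitions (`regMin`,
`gammaN08`) and theorems composing gen 0 (`BalabanUVNodesN08AlphaClassI ∕ …Discharge`), gen 2 (`…AlphaLoop28 ∕ …Threshold`), T4
(`BalabanUVNodesN08Constructed`) and the lane's `FamilyLE ∕ UVStability3D` BY NAME.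

WHY.  After gen 2 the (α) clause of record `UVStability3DInputs.RunAlpha 𝔊 𝔠 X 𝔖 𝔄` (hence N08 at the C-binding over the constructed run family)
follows from the cluster-expansion DATA (`RunDataRows` at the concrete sizes `sizesOf`) ∧ the THREE in-edge faces `InEdgeFaces₃` ∧ TWO SIDE CONDITIONS
that are artefacts of the typing, not sentences of print: (a) the window `∀ k < K, g_k ≤ γ_loop` («for g_{k−1} sufficiently small», p. 267 L7–8)
displayed BESIDE the family condition `g²ε₀ ≤ (min γ₀ 1)²`, and (b) `C68 ≤ 2L²B₃` — print has ONE regularity constant for `U_k` on `Ω_j` (the `B₃ε₁`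
of [7] Thm 1 (8); p. 267 L1–3 «|U_k(∂p) − 1| < B₃ … This implies |Ū_k^j(∂p′) − 1| < 4L²B₃g_{k−1}p(g_{k−1})(L^jη)²») where the lane's (α) rows carry
two NAMES for it, `C68` in (68) (`RunAlpha.h68`) and `8L²B₃` in (44) (`StepAlpha.h44`).
WHAT THIS FILE DOES.
* §1 `regMin 𝔠` — the constants record `𝔠` with `C68 ↦ min C68 (2L²B₃)`: the face `reg2` of `InEdgeFaces₃ 𝔊 (regMin 𝔠) X` reads [7] (2) at print's
  single constant (the smaller of the lane's two names), every OTHER object of the lane at `regMin 𝔠` is the object at `𝔠` (`regMin_lane`,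
  `regMin_b₀`, …, by `rfl`); `regLift_mono`.
* §2 `inEdgeFaces₃_of_regMin` (the faces at `𝔠` from the faces at `regMin 𝔠`), `inEdgeFaces₃_regMin_of_le` (conversely under gen 2's `C68 ≤ 2L²B₃` —
  so nothing is lost), `inEdgeFaces_of_regMin` (gen 0's FOUR faces at the concrete sizes from the three — `loop28` by gen 2's `loop28_of_reg2` AT
  `regMin 𝔠`, with NO constants condition), `runAlpha_of_data_faces₃_regMin`.
* §3 `gammaN08 𝔠 := min γ₀ (γ_loop (regMin 𝔠))` — ONE family threshold; on the family `g²ε₀ ≤ (min γ_N08 1)²` the window holds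
  (`gk_le_gammaLoop_of_le`, by `FamilyLE.gk_le_gamma0_of_le`) and the family lies in T4's (`le_gamma0_family_of_le`); hence
  `runAlpha_of_data_faces₃_of_le : g²ε₀ ≤ (min γ_N08 1)² → RunDataRows … → InEdgeFaces₃ 𝔊 (regMin 𝔠) X → RunAlpha 𝔊 𝔠 X 𝔖 𝔄` — NO window, NO
  constants condition.
* §4 T4's C-binding closers on ANY sub-family `ScalesLE L ((min γ 1)²)`, `0 ≤ γ ≤ γ₀` (`b10Compact_constructedLE_at`, `b10_main_constructedLE_upC_at`:
  `B10CompactBinding.b10_main_of_upC` ∕ `DagDischarged.b10Compact_withTowerRuns10_of_leafSystems` over `FamilyLE.runResiduals_of_alpha_le`), and N08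
  BY NAME from «DATA ∧ three faces» on the N08 family (`b10_main_constructedLE_upC_of_faces₃_family`, the record-predicate form
  `b10_main_at_record_of_faces₃Pin` whose displayed clause is EXACTLY «data schema ∧ three in-edge faces», (A1) `nonempty_scalesLE_gammaN08`).
* §5 the lane's END theorem on the N08 `≤`-family from «DATA ∧ three faces» (`uvStability3D_of_data_faces₃_le`, by
  `UVStability3D.uvStability3D_compact_subfamily`) and Theorem 2 on the exhibited family `S.ε₀ = ε₀_N08(S.g)` (`thm2_eps0Of_gammaN08`).
HONEST FRAMING: count-neutral kernel bookkeeping, NOT a discharge of N08: the cluster-expansion DATA (classes II + III of the census) and the three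
faces about the lane's FREE object `X.UkH` stay HYPOTHESES (the located item L2 `measUk` — [7] Thm 1 + Prop 9, no displayed statement — is
unchanged); the family threshold `γ_N08 ≤ γ₀` is a SMALLER «ε₀(g)» than T4's, equally «depending on g only» (print fixes no number; the pin chooses);
reading `reg2` at `min(C68, 2L²B₃)` asks of the pin exactly the regularity BOTH (α) rows `h68` and `h44` consume.  d = 3 lattice gauge theory on finite
tori as printed; nothing about d = 4, the continuum, OS axioms, a mass gap or the Clay problem.
-/

noncomputable section

namespace Summit.QuantumFields.YangMills.Theorems.BalabanUVNodesN08AlphaThreeFaces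

open MeasureTheory
open scoped BigOperators Matrix.Norms.L2Operator
open Literature.MathematicalPhysics.QuantumFieldTheory.Balaban1983to89
open Literature.MathematicalPhysics.QuantumFieldTheory.Balaban1983to89.B10
open Literature.MathematicalPhysics.QuantumFieldTheory.Balaban1983to89.B10SectCExpansion (TermSizes)
open Literature.MathematicalPhysics.QuantumFieldTheory.Balaban1985CMP102
open Literature.MathematicalPhysics.QuantumFieldTheory.Balaban1985CMP102.Setting
open Literature.MathematicalPhysics.QuantumFieldTheory.Balaban1985CMP102.Theorems (Family runs)
open Literature.MathematicalPhysics.QuantumFieldTheory.Balaban1983to89.DagBinding (leavesP WorldP PrintedCarriersR PrintedCarriers9X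
  PrintedCarriers11 PrintedCarriers14R PrintedCarriers15)
open Literature.MathematicalPhysics.QuantumFieldTheory.Balaban1983to89.DagDischarged (b10Compact)
open Literature.MathematicalPhysics.QuantumFieldTheory.Balaban1983to89.B10CompactBinding (ofPrintedAllXPNC)
open Summit.QuantumFields.Balaban3D.Carriers
open Summit.QuantumFields.Balaban3D.Proofs.Inputs
open Summit.QuantumFields.Balaban3D.Proofs.Primitives (AlphaConsts)
open Summit.QuantumFields.Balaban3D.Proofs.GroupModelLieC (lieC)
open Summit.QuantumFields.Balaban3D.Proofs.UVStability3DInputs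
open Summit.QuantumFields.Balaban3D.Proofs.UVStability3D (ConcreteLeaves leafSystem_of_concrete uvStability3D_compact_subfamily)
open Summit.QuantumFields.Balaban3D.Proofs.EndTheorem (carrierEqs_pin)
open Summit.QuantumFields.Balaban3D.Proofs.Residuals (analyticLeavesOf)
open Summit.QuantumFields.Balaban3D.Proofs.FamilyLE (ScalesLE runsLE le_of_eps0Of gk_le_gamma0_of_le runResiduals_of_alpha_le)
open Summit.QuantumFields.Balaban3D.Proofs.ScalesArithmetic (gk_pos gk_le_one)
open Summit.QuantumFields.Balaban3D.Proofs.Constants (eps0Of)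
open Summit.QuantumFields.Balaban3D.Proofs.CouplingWindow (pFun_pos)
open Summit.QuantumFields.Balaban3D.Proofs.LiftBridge (liftCfg)
open Summit.QuantumFields.YangMills.Theorems.BalabanUVNodesN08Constructed (nonempty_scalesLE nonempty_family_eps0Of)
open Summit.QuantumFields.YangMills.Theorems.BalabanUVNodesN08AlphaClassI
open Summit.QuantumFields.YangMills.Theorems.BalabanUVNodesN08AlphaClassIDischarge (runAlpha_of_data_faces)
open Summit.QuantumFields.YangMills.Theorems.BalabanUVNodesN08AlphaLoop28
open Summit.QuantumFields.YangMills.Theorems.BalabanUVNodesN08AlphaLoop28Threshold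

variable {L : ℕ}

/-! ## §1 [7] (2)'s face at print's single regularity constant: the record `regMin 𝔠` -/

section RegMin

variable {N : ℕ} (𝔠 : AlphaConsts L N)

/-- **THE CONSTANTS RECORD WITH `C68 ↦ min C68 (2L²B₃)`** — the lane's primitive constants `𝔠` with the (68) constant replaced by the smaller of the
two names the (α) rows give [7]'s ONE regularity constant for `U_k` on `Ω_j` (`C68` of (68) and `8L²B₃ = 4·(2L²B₃)` of (44), p. 267 L1–3); every
other field is `𝔠`'s. [cite: Balaban1985UV3, (68) p.273 + (44) p.267 + p.267 L1–3] -/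
def regMin : AlphaConsts L N :=
  { 𝔠 with
    C68 := min 𝔠.C68 (2 * (L : ℝ) ^ 2 * 𝔠.B₃)
    C68_pos := by
      have hB := 𝔠.B₃_pos
      have hL : (0 : ℝ) < L := by exact_mod_cast lt_trans zero_lt_one 𝔠.one_lt_L
      exact lt_min 𝔠.C68_pos (by positivity) }

/-- The (68) constant of `regMin 𝔠` is `min C68 (2L²B₃)`. [folklore] -/
theorem regMin_C68 : (regMin 𝔠).C68 = min 𝔠.C68 (2 * (L : ℝ) ^ 2 * 𝔠.B₃) := rfl

/-- … at most `C68`. [folklore] -/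
theorem regMin_C68_le : (regMin 𝔠).C68 ≤ 𝔠.C68 := min_le_left _ _

/-- … and gen 2's constants condition HOLDS for `regMin 𝔠`: `(regMin 𝔠).C68 ≤ 2L²·(regMin 𝔠).B₃` (`B₃` unchanged). [folklore] -/
theorem regMin_C68_le_B₃ : (regMin 𝔠).C68 ≤ 2 * (L : ℝ) ^ 2 * (regMin 𝔠).B₃ := min_le_right _ _

/-- The lane's constants record (carrier + step constants: `M₁`, `R₁`, `r₀`, `b₀`, `p₀`, `κ₀`, …), `b₀`, `p₀` and `B₃` are unchanged (`b₀` does not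
depend on `C68`, R-E2′) — so every object of the lane at `regMin 𝔠` other than the face `reg2` is the object at `𝔠`, definitionally. [folklore] -/
theorem regMin_lane : (regMin 𝔠).lane = 𝔠.lane ∧ (regMin 𝔠).b₀ = 𝔠.b₀ ∧ (regMin 𝔠).p₀ = 𝔠.p₀ ∧ (regMin 𝔠).B₃ = 𝔠.B₃ :=
  ⟨rfl, rfl, rfl, rfl⟩

/-- Under gen 2's side condition `C68 ≤ 2L²B₃` the record is unchanged in its (68) constant. [folklore] -/
theorem regMin_C68_of_le (h : 𝔠.C68 ≤ 2 * (L : ℝ) ^ 2 * 𝔠.B₃) : (regMin 𝔠).C68 = 𝔠.C68 := min_eq_left h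

end RegMin

/-- **MONOTONICITY OF [7] (2)'s PLAQUETTE CLAUSE IN ITS CONSTANT**: regular at threshold `θ` ⇒ regular at any `θ′ ≥ θ`. [cite: Balaban1985Variational, (2) p.278] -/
theorem regLift_mono (S : Scales L) {N : ℕ} (j : ℕ) (Xs : Set (Site S.P 0)) {θ θ' : ℝ} (hθ : θ ≤ θ')
    (Ul : B7Prop1Explicit.Site S.P.d → Fin S.P.d → (Matrix (Fin N) (Fin N) ℂ)ˣ) (h : RegLift S j Xs θ Ul) : RegLift S j Xs θ' Ul :=
  fun x μ ν hμν hx => (h x μ ν hμν hx).trans_le (mul_le_mul_of_nonneg_right hθ (sq_nonneg _))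

/-! ## §2 The three faces at `regMin 𝔠` give gen 0's four faces at `𝔠` — no constants condition -/

section Faces

variable {S : Scales L} {G : Type} [GaugeGroup G] [MeasurableSpace G] [HaarData G] (𝔊 : GroupModel G) (𝔠 : AlphaConsts L 𝔊.N)
  (X : ExternalInputs S G)

/-- **THE THREE FACES AT `𝔠` FROM THE THREE FACES AT `regMin 𝔠`**: `measUk` and `inB42` are literally the same sentences (the lane's carrier constants
do not involve `C68`), and `reg2` at the constant `C68·g_jp(g_j)` follows from `reg2` at `min(C68, 2L²B₃)·g_jp(g_j)` (`regLift_mono`).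
[cite: Balaban1985Variational, (2)–(3) p.278 + Thm 1 (8) p.279] -/
theorem inEdgeFaces₃_of_regMin (F : InEdgeFaces₃ 𝔊 (regMin 𝔠) X) : InEdgeFaces₃ 𝔊 𝔠 X where
  measUk := F.measUk
  inB42 := F.inB42
  reg2 k hk h hh U j hj := by
    have hq : 0 ≤ S.gk j * pFun 𝔠.lane.carrier.b₀ 𝔠.lane.carrier.p₀ (S.gk j) :=
      (mul_pos (gk_pos S j) (pFun_pos _ _ _ 𝔠.b₀_pos (gk_pos S j) (gk_le_one S S.gK_le_one j (by omega)))).le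
    exact regLift_mono S j _ (mul_le_mul_of_nonneg_right (regMin_C68_le 𝔠) hq) _ (F.reg2 k hk h hh U j hj)

/-- **CONVERSELY, UNDER GEN 2's SIDE CONDITION `C68 ≤ 2L²B₃` THE FACES AT `𝔠` ARE THE FACES AT `regMin 𝔠`** (then `min(C68, 2L²B₃) = C68`): the
new hypothesis is gen 2's exactly, on gen 2's terms. [cite: Balaban1985Variational, (2)–(3) p.278] -/
theorem inEdgeFaces₃_regMin_of_le (hC68 : 𝔠.C68 ≤ 2 * (L : ℝ) ^ 2 * 𝔠.B₃) (F : InEdgeFaces₃ 𝔊 𝔠 X) :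
    InEdgeFaces₃ 𝔊 (regMin 𝔠) X where
  measUk := F.measUk
  inB42 := F.inB42
  reg2 k hk h hh U j hj := by
    have h := F.reg2 k hk h hh U j hj
    have hq : 0 ≤ S.gk j * pFun 𝔠.lane.carrier.b₀ 𝔠.lane.carrier.p₀ (S.gk j) :=
      (mul_pos (gk_pos S j) (pFun_pos _ _ _ 𝔠.b₀_pos (gk_pos S j) (gk_le_one S S.gK_le_one j (by omega)))).le
    exact regLift_mono S j _ (mul_le_mul_of_nonneg_right (regMin_C68_of_le 𝔠 hC68).ge hq) _ h

/-- **GEN 0's FOUR FACES AT THE CONCRETE SIZES FROM THE THREE FACES AT `regMin 𝔠`** under the displayed smallness `LoopSmall 𝔊 (regMin 𝔠)` — and NO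
constants condition: (44)'s loop input `loop28` is gen 2's `loop28_of_reg2` at the record `regMin 𝔠`, whose condition `C68 ≤ 2L²B₃` HOLDS there
(`regMin_C68_le_B₃`) and whose objects (sizes, `B₃`, `b₀`, `p₀`) are `𝔠`'s. [cite: Balaban1985UV3, (44) p.267 + p.267 L1–3] -/
theorem inEdgeFaces_of_regMin (coef : (k : ℕ) → Hist S.P (k + 1) → GaugeField S.P (k + 1) G → (j : ℕ) → TermSizes (oldGeom S.P k j))
    (F : InEdgeFaces₃ 𝔊 (regMin 𝔠) X) (hsm : LoopSmall 𝔊 (regMin 𝔠) (S := S)) :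
    InEdgeFaces 𝔊 𝔠 X (sizesOf 𝔊 𝔠 X coef) where
  measUk := F.measUk
  loop28 := loop28_of_reg2 𝔊 (regMin 𝔠) X coef F.reg2 hsm (regMin_C68_le_B₃ 𝔠)
  inB42 := F.inB42
  reg2 := (inEdgeFaces₃_of_regMin 𝔊 𝔠 X F).reg2

variable (𝔖 : ∀ k, StepSeries S G ↥(lieC 𝔊) (nblkOf S 𝔠.lane.carrier k) k) (𝔄 : AlphaData 𝔊 𝔠 X 𝔖)

/-- **THE (α) CLAUSE FROM «DATA ∧ THREE FACES» ON THE WINDOW `g_k ≤ γ_loop(regMin 𝔠)` — NO CONSTANTS CONDITION** (gen 2's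
`runAlpha_of_data_faces₃` ∘ `loopSmall_of_le_gammaLoop` at `regMin 𝔠`). [cite: Balaban1985UV3, (41) p.266 + (44) p.267 + (47) p.267] -/
theorem runAlpha_of_data_faces₃_regMin
    (coef : (k : ℕ) → Hist S.P (k + 1) → GaugeField S.P (k + 1) G → (j : ℕ) → TermSizes (oldGeom S.P k j))
    (D : RunDataRows 𝔊 𝔠 X 𝔖 𝔄 (sizesOf 𝔊 𝔠 X coef)) (F : InEdgeFaces₃ 𝔊 (regMin 𝔠) X)
    (hγ : ∀ k, k + 1 ≤ S.K → S.gk k ≤ gammaLoop (regMin 𝔠)) : RunAlpha 𝔊 𝔠 X 𝔖 𝔄 :=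
  runAlpha_of_data_faces D (inEdgeFaces_of_regMin 𝔊 𝔠 X coef F (loopSmall_of_le_gammaLoop 𝔊 (regMin 𝔠) hγ))

end Faces

/-! ## §3 The N08 family threshold `γ_N08 = min γ₀ γ_loop(regMin 𝔠)`: the window from the family condition -/

section Threshold

variable {N : ℕ} (𝔠 : AlphaConsts L N)

/-- **`γ_N08 := min γ₀ (γ_loop (regMin 𝔠))`** — ONE threshold below which the lane's leaf thresholds (`γ₀ = min(γ₂₈, γ₄₆, γ_OO, γ₇₁)`,
`Primitives.AlphaConsts.gamma0`) AND gen 2's loop window `γ_loop` (at print's single regularity constant) hold; «ε₀ is a positive constant depending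
on the coupling constant g only» with `ε₀(g) = (min γ_N08 1)²∕g²`. [cite: Balaban1985UV3, p.256 L15–18 + p.267 L7–8] -/
def gammaN08 : ℝ := min 𝔠.gamma0 (gammaLoop (regMin 𝔠))

/-- `γ_N08 > 0`. [folklore] -/
theorem gammaN08_pos : 0 < gammaN08 𝔠 := lt_min 𝔠.gamma0_pos (gammaLoop_pos_le (regMin 𝔠)).1

/-- `γ_N08 ≤ γ₀`. [folklore] -/
theorem gammaN08_le_gamma0 : gammaN08 𝔠 ≤ 𝔠.gamma0 := min_le_left _ _

/-- `γ_N08 ≤ γ_loop (regMin 𝔠) ≤ 1`. [folklore] -/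
theorem gammaN08_le_gammaLoop : gammaN08 𝔠 ≤ gammaLoop (regMin 𝔠) ∧ gammaN08 𝔠 ≤ 1 :=
  ⟨min_le_right _ _, (min_le_right _ _).trans (gammaLoop_pos_le (regMin 𝔠)).2⟩

/-- Family thresholds are monotone: `0 ≤ γ ≤ γ′ ⇒ (min γ 1)² ≤ (min γ′ 1)²`. [folklore] -/
theorem sq_min_one_mono {γ γ' : ℝ} (h0 : 0 ≤ γ) (h : γ ≤ γ') : (min γ 1) ^ 2 ≤ (min γ' 1) ^ 2 :=
  pow_le_pow_left₀ (le_min h0 zero_le_one) (min_le_min_right 1 h) 2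

/-- **(A1) THE N08 FAMILIES ARE INHABITED** (`L` odd `> 1`): `ScalesLE L ((min γ_N08 1)²)` and the exhibited `Family L (ε₀_N08)` are non-empty
(T4's `nonempty_scalesLE` ∕ `nonempty_family_eps0Of` at `γ_N08 > 0`) — a pin of `runs10` to them is not a pin to an empty family. [cite: Balaban1985UV3, (2)–(3) p.256] -/
theorem nonempty_scalesLE_gammaN08 (hL : Odd L ∧ 1 < L) :
    Nonempty (ScalesLE L ((min (gammaN08 𝔠) 1) ^ 2)) ∧ Nonempty (Family L (eps0Of (gammaN08 𝔠))) :=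
  ⟨nonempty_scalesLE hL (gammaN08_pos 𝔠), nonempty_family_eps0Of hL (gammaN08_pos 𝔠)⟩

variable {S : Scales L}

/-- **THE N08 FAMILY LIES IN T4's FAMILY**: `g²ε₀ ≤ (min γ_N08 1)² ⇒ g²ε₀ ≤ (min γ₀ 1)²`. [cite: Balaban1985UV3, p.256 L15–18] -/
theorem le_gamma0_family_of_le (hle : S.g ^ 2 * S.ε₀ ≤ (min (gammaN08 𝔠) 1) ^ 2) : S.g ^ 2 * S.ε₀ ≤ (min 𝔠.gamma0 1) ^ 2 :=
  hle.trans (sq_min_one_mono (gammaN08_pos 𝔠).le (gammaN08_le_gamma0 𝔠))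

/-- **THE LOOP WINDOW FROM THE FAMILY CONDITION**: on `g²ε₀ ≤ (min γ_N08 1)²` every running coupling `g_k`, `k < K` (indeed `k ≤ K`), is below
`γ_loop (regMin 𝔠)` (`FamilyLE.gk_le_gamma0_of_le`: `g_k² ≤ g_K² = g²ε₀`). [cite: Balaban1985UV3, (2) + (5) p.256 + p.267 L7–8] -/
theorem gk_le_gammaLoop_of_le (hle : S.g ^ 2 * S.ε₀ ≤ (min (gammaN08 𝔠) 1) ^ 2) (k : ℕ) (hk : k + 1 ≤ S.K) :
    S.gk k ≤ gammaLoop (regMin 𝔠) :=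
  (gk_le_gamma0_of_le S (gammaN08_pos 𝔠).le hle k (by omega)).trans (gammaN08_le_gammaLoop 𝔠).1

/-- The same for every `k ≤ K` (the terminal coupling included). [cite: Balaban1985UV3, (2) + (5) p.256] -/
theorem gk_le_gammaN08_of_le (hle : S.g ^ 2 * S.ε₀ ≤ (min (gammaN08 𝔠) 1) ^ 2) (k : ℕ) (hk : k ≤ S.K) : S.gk k ≤ gammaN08 𝔠 :=
  gk_le_gamma0_of_le S (gammaN08_pos 𝔠).le hle k hk

end Threshold

section Alpha

variable {S : Scales L} {G : Type} [GaugeGroup G] [MeasurableSpace G] [HaarData G] (𝔊 : GroupModel G) (𝔠 : AlphaConsts L 𝔊.N)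
  (X : ExternalInputs S G)

omit [HaarData G] in
/-- **THE DISPLAYED SMALLNESS OF (44)'s LOOP INPUT ON THE N08 FAMILY**: `LoopSmall 𝔊 (regMin 𝔠)` from `g²ε₀ ≤ (min γ_N08 1)²`
(`loopSmall_of_le_gammaLoop` ∘ `gk_le_gammaLoop_of_le`). [cite: Balaban1985UV3, p.267 L7–8 + (43)–(44) pp.266–267] -/
theorem loopSmall_of_le (hle : S.g ^ 2 * S.ε₀ ≤ (min (gammaN08 𝔠) 1) ^ 2) : LoopSmall 𝔊 (regMin 𝔠) (S := S) :=
  loopSmall_of_le_gammaLoop 𝔊 (regMin 𝔠) (gk_le_gammaLoop_of_le 𝔠 hle)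

variable (𝔖 : ∀ k, StepSeries S G ↥(lieC 𝔊) (nblkOf S 𝔠.lane.carrier k) k) (𝔄 : AlphaData 𝔊 𝔠 X 𝔖)

/-- **THE (α) CLAUSE OF RECORD FROM «DATA ∧ THREE IN-EDGE FACES» ALONE, ON THE N08 FAMILY `g²ε₀ ≤ (min γ_N08 1)²`**: `RunAlpha 𝔊 𝔠 X 𝔖 𝔄` from
the cluster-expansion data schema at the concrete sizes (`RunDataRows`, classes II + III of the census with (43)'s form) and the three in-edge faces
`InEdgeFaces₃ 𝔊 (regMin 𝔠) X` ([7] Thm 1 + Prop 9 measurability, [7] (3) = (42), [7] (2)∕(8) at print's single constant) — no coupling window,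
no constants condition: both are now inside the family threshold `γ_N08` and the record `regMin 𝔠`.  What remains DISPLAYED of the lane's (α)
clause is exactly: the DATA and the three in-edge sentences about `X.UkH`. [cite: Balaban1985UV3, (41) p.266 + (44) p.267 + (47) p.267 + p.256 L15–18] -/
theorem runAlpha_of_data_faces₃_of_le
    (coef : (k : ℕ) → Hist S.P (k + 1) → GaugeField S.P (k + 1) G → (j : ℕ) → TermSizes (oldGeom S.P k j))
    (hle : S.g ^ 2 * S.ε₀ ≤ (min (gammaN08 𝔠) 1) ^ 2)
    (D : RunDataRows 𝔊 𝔠 X 𝔖 𝔄 (sizesOf 𝔊 𝔠 X coef)) (F : InEdgeFaces₃ 𝔊 (regMin 𝔠) X) : RunAlpha 𝔊 𝔠 X 𝔖 𝔄 :=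
  runAlpha_of_data_faces₃_regMin 𝔊 𝔠 X 𝔖 𝔄 coef D F (gk_le_gammaLoop_of_le 𝔠 hle)

end Alpha

/-! ## §4 T4's C-binding closers on a sub-family `g²ε₀ ≤ (min γ 1)²`, `γ ≤ γ₀`, and N08 BY NAME from «DATA ∧ three faces» on the N08 family -/

section N08

variable {G : Type} [GaugeGroup G] [MeasurableSpace G] [HaarData G] {𝔊 : GroupModel G} {𝔠 : AlphaConsts L 𝔊.N}
  {X : ∀ S : Scales L, ExternalInputs S G}
  {𝔖 : ∀ (S : Scales L) (k : ℕ), StepSeries S G ↥(lieC 𝔊) (nblkOf S 𝔠.lane.carrier k) k}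
  {𝔄 : ∀ S : Scales L, AlphaData 𝔊 𝔠 (X S) (𝔖 S)}
  {coef : ∀ (S : Scales L) (k : ℕ), Hist S.P (k + 1) → GaugeField S.P (k + 1) G → (j : ℕ) → TermSizes (oldGeom S.P k j)}
  {Xc : PrintedCarriersR} {Y : PrintedCarriers9X} {Z : PrintedCarriers11} {V : PrintedCarriers14R} {W : PrintedCarriers15}
  {w : WorldP} {P : B12.RunParams}

/-- **THEOREM 1 (compact reading) ∧ THEOREM 2 FOR THE CONSTRUCTED DENSITIES = THE C-BINDING'S LEAF, ON ANY SUB-FAMILY `g²ε₀ ≤ (min γ 1)²`, `0 ≤ γ ≤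
γ₀`** (T4's `b10Compact_constructedLE` with the threshold a parameter: the sub-family lies in T4's, `sq_min_one_mono`, and T4's leaf bundle is rebuilt
there from `FamilyLE.runResiduals_of_alpha_le`). [cite: Balaban1985UV3, Thm 1 p.257 (compact reading) + Thm 2 p.272 + p.256 L15–18] -/
theorem b10Compact_constructedLE_at {γ : ℝ} (hγ0 : 0 ≤ γ) (hγ : γ ≤ 𝔠.gamma0)
    (hα : ∀ S : Scales L, S.g ^ 2 * S.ε₀ ≤ (min γ 1) ^ 2 → RunAlpha 𝔊 𝔠 (X S) (𝔖 S) (𝔄 S)) (Xc : PrintedCarriersR) :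
    b10Compact (Xc.withTowerRuns10 fun S : ScalesLE L ((min γ 1) ^ 2) =>
      towerOf 𝔠.lane (X S.1) (𝔖 S.1)).toPrintedCarriers :=
  DagDischarged.b10Compact_withTowerRuns10_of_leafSystems Xc _ fun S =>
    leafSystem_of_concrete 𝔠.lane.normalised
      ({ toCarrierEqs := carrierEqs_pin _ (usesConsts_inputOf 𝔠.lane (X S.1) (𝔖 S.1) fun _ => True)
         toAnalyticLeaves := analyticLeavesOf
           (runResiduals_of_alpha_le (S.2.trans (sq_min_one_mono hγ0 hγ)) (hα S.1 S.2)) } :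
        ConcreteLeaves 𝔠.lane.consts S.1 (towerOf 𝔠.lane (X S.1) (𝔖 S.1)))

/-- **N08 BY NAME AT THE C-BINDING OF RECORD OVER THE CONSTRUCTED RUN FAMILY, ON ANY SUB-FAMILY `g²ε₀ ≤ (min γ 1)²`, `0 ≤ γ ≤ γ₀`** (T4's
`b10_main_constructedLE_upC` with the threshold a parameter; `B10CompactBinding.b10_main_of_upC`). [cite: Balaban1985UV3, Thm 1 p.257 (compact reading) + Thm 2 p.272] -/
theorem b10_main_constructedLE_upC_at {γ : ℝ} (hγ0 : 0 ≤ γ) (hγ : γ ≤ 𝔠.gamma0)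
    (hα : ∀ S : Scales L, S.g ^ 2 * S.ε₀ ≤ (min γ 1) ^ 2 → RunAlpha 𝔊 𝔠 (X S) (𝔖 S) (𝔄 S))
    (hup : w.up P = ofPrintedAllXPNC (Xc.withTowerRuns10 fun S : ScalesLE L ((min γ 1) ^ 2) =>
      towerOf 𝔠.lane (X S.1) (𝔖 S.1)) Y Z V W) :
    Dag.B10_main (leavesP w P) :=
  B10CompactBinding.b10_main_of_upC (fun S : ScalesLE L ((min γ 1) ^ 2) =>
    leafSystem_of_concrete 𝔠.lane.normalised
      ({ toCarrierEqs := carrierEqs_pin _ (usesConsts_inputOf 𝔠.lane (X S.1) (𝔖 S.1) fun _ => True)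
         toAnalyticLeaves := analyticLeavesOf
           (runResiduals_of_alpha_le (S.2.trans (sq_min_one_mono hγ0 hγ)) (hα S.1 S.2)) } :
        ConcreteLeaves 𝔠.lane.consts S.1 (towerOf 𝔠.lane (X S.1) (𝔖 S.1)))) hup

/-- **THEOREM 1 (compact reading) ∧ THEOREM 2 FOR THE CONSTRUCTED DENSITIES ON THE N08 FAMILY, from «DATA ∧ three faces» alone.**
[cite: Balaban1985UV3, Thm 1 p.257 (compact reading) + Thm 2 p.272] -/
theorem b10Compact_constructedLE_of_faces₃_family
    (hD : ∀ S : Scales L, S.g ^ 2 * S.ε₀ ≤ (min (gammaN08 𝔠) 1) ^ 2 →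
      RunDataRows 𝔊 𝔠 (X S) (𝔖 S) (𝔄 S) (sizesOf 𝔊 𝔠 (X S) (coef S)))
    (hF : ∀ S : Scales L, S.g ^ 2 * S.ε₀ ≤ (min (gammaN08 𝔠) 1) ^ 2 → InEdgeFaces₃ 𝔊 (regMin 𝔠) (X S)) (Xc : PrintedCarriersR) :
    b10Compact (Xc.withTowerRuns10 fun S : ScalesLE L ((min (gammaN08 𝔠) 1) ^ 2) =>
      towerOf 𝔠.lane (X S.1) (𝔖 S.1)).toPrintedCarriers :=
  b10Compact_constructedLE_at (gammaN08_pos 𝔠).le (gammaN08_le_gamma0 𝔠)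
    (fun S hS => runAlpha_of_data_faces₃_of_le 𝔊 𝔠 (X S) (𝔖 S) (𝔄 S) (coef S) hS (hD S hS) (hF S hS)) Xc

/-- **N08 BY NAME AT THE C-BINDING OF RECORD OVER THE CONSTRUCTED RUN FAMILY ON THE N08 FAMILY, from «DATA ∧ three faces» alone**: at `w.up P =
ofPrintedAllXPNC (Xc.withTowerRuns10 (S ↦ towerOf 𝔠.lane (X S) (𝔖 S))) Y Z V W` over `ScalesLE L ((min γ_N08 1)²)`, `Dag.B10_main (leavesP w P)` — the
hypotheses are the cluster-expansion DATA at the concrete sizes and the three in-edge faces, nothing else. [cite: Balaban1985UV3, Thm 1 p.257 (compact reading) + Thm 2 p.272] -/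
theorem b10_main_constructedLE_upC_of_faces₃_family
    (hD : ∀ S : Scales L, S.g ^ 2 * S.ε₀ ≤ (min (gammaN08 𝔠) 1) ^ 2 →
      RunDataRows 𝔊 𝔠 (X S) (𝔖 S) (𝔄 S) (sizesOf 𝔊 𝔠 (X S) (coef S)))
    (hF : ∀ S : Scales L, S.g ^ 2 * S.ε₀ ≤ (min (gammaN08 𝔠) 1) ^ 2 → InEdgeFaces₃ 𝔊 (regMin 𝔠) (X S))
    (hup : w.up P = ofPrintedAllXPNC (Xc.withTowerRuns10 fun S : ScalesLE L ((min (gammaN08 𝔠) 1) ^ 2) =>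
      towerOf 𝔠.lane (X S.1) (𝔖 S.1)) Y Z V W) :
    Dag.B10_main (leavesP w P) :=
  b10_main_constructedLE_upC_at (gammaN08_pos 𝔠).le (gammaN08_le_gamma0 𝔠)
    (fun S hS => runAlpha_of_data_faces₃_of_le 𝔊 𝔠 (X S) (𝔖 S) (𝔄 S) (coef S) hS (hD S hS) (hF S hS)) hup

end N08

section Record

variable {G : Type} [GaugeGroup G] [MeasurableSpace G] [HaarData G] {𝔊 : GroupModel G}

/-- **RECORD-PREDICATE FORM WITH THE DISPLAYED CLAUSE «DATA SCHEMA ∧ THREE IN-EDGE FACES» AND NOTHING ELSE** (the shape of `S_N08 Rec := AtRecord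
Rec Dag.B10_main` at a C-bound `Rec`, chair R434 (c1) idiom «ESTIMATE ASSUMED AS ADMISSIBILITY»): for any predicate `Rec` on binding worlds under
which, at every run, SOME constants ∕ external inputs ∕ expansion data ∕ auxiliary data ∕ coefficient sizes — whose cluster-expansion DATA SCHEMA
(at the concrete loop sizes) and THREE IN-EDGE FACES ([7] Thm 1 + Prop 9, [7] (3) = (42), [7] (2)∕(8) at print's single constant) hold on the N08
family `g²ε₀ ≤ (min γ_N08 1)²` — bind the upstream as the C-binding over carriers whose B10 runs ARE the constructed family, N08 holds at every
`Rec`-world and run.  Gen 0's `b10_main_at_record_of_facesPin` without the face `loop28`; gen 2's closer without its window and constants condition.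
[cite: Balaban1985UV3, Thm 1 p.257 (compact reading) + Thm 2 p.272 (bookkeeping shape)] -/
theorem b10_main_at_record_of_faces₃Pin (Rec : WorldP → Prop)
    (hpin : ∀ w, Rec w → ∀ P : B12.RunParams,
      ∃ (𝔠 : AlphaConsts L 𝔊.N) (X : ∀ S : Scales L, ExternalInputs S G)
        (𝔖 : ∀ (S : Scales L) (k : ℕ), StepSeries S G ↥(lieC 𝔊) (nblkOf S 𝔠.lane.carrier k) k)
        (𝔄 : ∀ S : Scales L, AlphaData 𝔊 𝔠 (X S) (𝔖 S))
        (coef : ∀ (S : Scales L) (k : ℕ), Hist S.P (k + 1) → GaugeField S.P (k + 1) G → (j : ℕ) → TermSizes (oldGeom S.P k j))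
        (Xc : PrintedCarriersR) (Y : PrintedCarriers9X) (Z : PrintedCarriers11) (V : PrintedCarriers14R) (W : PrintedCarriers15),
        (∀ S : Scales L, S.g ^ 2 * S.ε₀ ≤ (min (gammaN08 𝔠) 1) ^ 2 →
            RunDataRows 𝔊 𝔠 (X S) (𝔖 S) (𝔄 S) (sizesOf 𝔊 𝔠 (X S) (coef S)) ∧ InEdgeFaces₃ 𝔊 (regMin 𝔠) (X S)) ∧
          w.up P = ofPrintedAllXPNC (Xc.withTowerRuns10 fun S : ScalesLE L ((min (gammaN08 𝔠) 1) ^ 2) =>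
            towerOf 𝔠.lane (X S.1) (𝔖 S.1)) Y Z V W) :
    ∀ w, Rec w → ∀ P, Dag.B10_main (leavesP w P) := by
  intro w hw P
  obtain ⟨𝔠, X, 𝔖, 𝔄, coef, Xc, Y, Z, V, W, hα, hup⟩ := hpin w hw P
  exact b10_main_constructedLE_upC_of_faces₃_family (coef := coef) (fun S hS => (hα S hS).1) (fun S hS => (hα S hS).2) hup

end Record

/-! ## §5 The lane's END theorem on the N08 `≤`-family from «DATA ∧ three faces» -/

section End

/-- **BAŁABAN CMP 102 (1985), THEOREM 1 (compact-coupling-window reading) ∧ THEOREM 2 ON THE N08 `≤`-FAMILY, FROM «DATA SCHEMA ∧ THREE IN-EDGE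
FACES»**: for one group as printed `(G, 𝔊)`, IF for every lattice approximation with `g²ε₀ ≤ (min γ_N08 1)²` the cluster-expansion data schema (at the
concrete sizes) and the three in-edge faces (at print's single regularity constant) hold, THEN the densities of the CONSTRUCTED runs
`(laneT 𝔠 X 𝔖).toConstruction` satisfy the bounds (5) with ONE O(1) per coupling window, uniformly over that family, and (41) ∧ (47) for every `k ≤ K`
— `UVStability3D.uvStability3D_compact_subfamily` on `ScalesLE L ((min γ_N08 1)²)` with the leaves from `FamilyLE.runResiduals_of_alpha_le` ∘
`runAlpha_of_data_faces₃_of_le`.  The lane's `FamilyLE.uvStability3D_of_inputs_le` with `RunAlpha` REPLACED by «DATA ∧ three faces» and `γ₀` by `γ_N08`.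
[cite: Balaban1985UV3, Thm 1 p.257 + Thm 2 p.272 + p.256 L15–18] -/
theorem uvStability3D_of_data_faces₃_le
    (𝔠 : ∀ (G : Type) [GaugeGroup G] [MeasurableSpace G] [HaarData G] (𝔊 : GroupModel G), AlphaConsts L 𝔊.N)
    (X : ∀ (G : Type) [GaugeGroup G] [MeasurableSpace G] [HaarData G], GroupModel G → ∀ S : Scales L, ExternalInputs S G)
    (𝔖 : ∀ (G : Type) [GaugeGroup G] [MeasurableSpace G] [HaarData G] (𝔊 : GroupModel G) (S : Scales L) (k : ℕ),
      StepSeries S G ↥(lieC 𝔊) (nblkOf S (𝔠 G 𝔊).lane.carrier k) k)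
    (𝔄 : ∀ (G : Type) [GaugeGroup G] [MeasurableSpace G] [HaarData G] (𝔊 : GroupModel G) (S : Scales L),
      AlphaData 𝔊 (𝔠 G 𝔊) (X G 𝔊 S) (𝔖 G 𝔊 S))
    (G : Type) [GaugeGroup G] [MeasurableSpace G] [HaarData G] (𝔊 : GroupModel G)
    (coef : ∀ (S : Scales L) (k : ℕ), Hist S.P (k + 1) → GaugeField S.P (k + 1) G → (j : ℕ) → TermSizes (oldGeom S.P k j))
    (hD : ∀ S : Scales L, S.g ^ 2 * S.ε₀ ≤ (min (gammaN08 (𝔠 G 𝔊)) 1) ^ 2 →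
      RunDataRows 𝔊 (𝔠 G 𝔊) (X G 𝔊 S) (𝔖 G 𝔊 S) (𝔄 G 𝔊 S) (sizesOf 𝔊 (𝔠 G 𝔊) (X G 𝔊 S) (coef S)))
    (hF : ∀ S : Scales L, S.g ^ 2 * S.ε₀ ≤ (min (gammaN08 (𝔠 G 𝔊)) 1) ^ 2 → InEdgeFaces₃ 𝔊 (regMin (𝔠 G 𝔊)) (X G 𝔊 S)) :
    Thm1PrintedCompact (runsLE (laneT 𝔠 X 𝔖).toConstruction G 𝔊 ((min (gammaN08 (𝔠 G 𝔊)) 1) ^ 2)) ∧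
      Thm2Printed (runsLE (laneT 𝔠 X 𝔖).toConstruction G 𝔊 ((min (gammaN08 (𝔠 G 𝔊)) 1) ^ 2)) :=
  uvStability3D_compact_subfamily (laneT 𝔠 X 𝔖).toConstruction (𝔠 G 𝔊).lane.consts (𝔠 G 𝔊).lane.normalised (laneT 𝔠 X 𝔖).tower
    (fun G _ _ _ 𝔊 S => (laneT 𝔠 X 𝔖).tower_toRunData G 𝔊 S) (fun S : ScalesLE L ((min (gammaN08 (𝔠 G 𝔊)) 1) ^ 2) => S.1) G 𝔊
    (fun S => { toCarrierEqs := carrierEqs_pin _ (usesConsts_inputOf (𝔠 G 𝔊).lane (X G 𝔊 S.1) (𝔖 G 𝔊 S.1) fun _ => True),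
                toAnalyticLeaves := analyticLeavesOf (runResiduals_of_alpha_le (le_gamma0_family_of_le (𝔠 G 𝔊) S.2)
                  (runAlpha_of_data_faces₃_of_le 𝔊 (𝔠 G 𝔊) (X G 𝔊 S.1) (𝔖 G 𝔊 S.1) (𝔄 G 𝔊 S.1) (coef S.1) S.2
                    (hD S.1 S.2) (hF S.1 S.2))) })

/-- **THEOREM 2 ON THE EXHIBITED N08 FAMILY `S.ε₀ = ε₀_N08(S.g) = (min γ_N08 1)²∕S.g²`, from «DATA ∧ three faces»** (restriction of the `≤`-reading,
`FamilyLE.le_of_eps0Of`). [cite: Balaban1985UV3, Thm 2 p.272 + (2) p.256] -/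
theorem thm2_eps0Of_gammaN08
    (𝔠 : ∀ (G : Type) [GaugeGroup G] [MeasurableSpace G] [HaarData G] (𝔊 : GroupModel G), AlphaConsts L 𝔊.N)
    (X : ∀ (G : Type) [GaugeGroup G] [MeasurableSpace G] [HaarData G], GroupModel G → ∀ S : Scales L, ExternalInputs S G)
    (𝔖 : ∀ (G : Type) [GaugeGroup G] [MeasurableSpace G] [HaarData G] (𝔊 : GroupModel G) (S : Scales L) (k : ℕ),
      StepSeries S G ↥(lieC 𝔊) (nblkOf S (𝔠 G 𝔊).lane.carrier k) k)
    (𝔄 : ∀ (G : Type) [GaugeGroup G] [MeasurableSpace G] [HaarData G] (𝔊 : GroupModel G) (S : Scales L),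
      AlphaData 𝔊 (𝔠 G 𝔊) (X G 𝔊 S) (𝔖 G 𝔊 S))
    (G : Type) [GaugeGroup G] [MeasurableSpace G] [HaarData G] (𝔊 : GroupModel G)
    (coef : ∀ (S : Scales L) (k : ℕ), Hist S.P (k + 1) → GaugeField S.P (k + 1) G → (j : ℕ) → TermSizes (oldGeom S.P k j))
    (hD : ∀ S : Scales L, S.g ^ 2 * S.ε₀ ≤ (min (gammaN08 (𝔠 G 𝔊)) 1) ^ 2 →
      RunDataRows 𝔊 (𝔠 G 𝔊) (X G 𝔊 S) (𝔖 G 𝔊 S) (𝔄 G 𝔊 S) (sizesOf 𝔊 (𝔠 G 𝔊) (X G 𝔊 S) (coef S)))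
    (hF : ∀ S : Scales L, S.g ^ 2 * S.ε₀ ≤ (min (gammaN08 (𝔠 G 𝔊)) 1) ^ 2 → InEdgeFaces₃ 𝔊 (regMin (𝔠 G 𝔊)) (X G 𝔊 S)) :
    Thm2Printed (runs (laneT 𝔠 X 𝔖).toConstruction G 𝔊 (eps0Of (gammaN08 (𝔠 G 𝔊)))) :=
  fun S k hk => (uvStability3D_of_data_faces₃_le 𝔠 X 𝔖 𝔄 G 𝔊 coef hD hF).2 ⟨S.1, le_of_eps0Of S.1 S.2⟩ k hk

end End

end Summit.QuantumFields.YangMills.Theorems.BalabanUVNodesN08AlphaThreeFaces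

end
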